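import Literature.NumberTheory.GelbartRogawski1991.LocalSplittingCMScaleTransport
import Literature.NumberTheory.GelbartRogawski1991.LocalKudlaSplittingRigiditySplit
import Literature.NumberTheory.GelbartRogawski1991.LocalDoubledGaloisConjSiegelNonsplit
import HarnessLib

/-!
# Kudla rigidity under `g ↦ ḡ`: the conjugate of the doubled CM section is the scale-transported section of the conjugate data

Topic `NumberTheory/GelbartRogawski1991`; namespace `Literature.NumberTheory.GelbartRogawski1991.UnitaryDualPair.LocalSplitting`.  KERNEL ONLY:
theorems; no definition, no named fact, no `sorry`.  Cell `hodgecm-mathlib` (D-0151), programme P5 (crux HLiu418 = stmt-HodgeConjecture-24832), piece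
**P1 (doubled level)** of the road card `F0/P5/A-p18/g23/ROAD-L4if-v2.A-p18g23.md` §4 (A-p18 (g23), 2026-08-31) — the DOUBLED core of step (M1)
of the in-house road for the letter L4if ([Liu2021, Lem. D.1 (4)] «if», non-split places): it PINS the Galois-conjugated CM section with NO
leftover character.

THE MATHEMATICS ([Kudla1994, §3 Thm. 3.1]; [HarrisKudlaSweet1996, §1 (1.11)–(1.16)]; [GelbartRogawski1991, §3.1 Remark p. 457]).  `L` CM, `F = L⁺`,
`v` a finite place of `F` that is NON-SPLIT in `L` (all `w ∣ v` fixed by `c`), `T₀ ∈ Sym_n(F)` diagonal invertible, `H(F_v) = U(T₀ ⊕ −T₀)(F_v)`, and the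
tree's `P_Δ`-normalised doubled CM section `Σ_χ = (localSplittingDatumCM L v μ n hT₀ hT₀d rfl χ hχ).localSplitting` of a splitting Hecke character `χ`
(★ `LocalDoubledUnitarySplittingDataCM`; a section of `H(F_v)` over `ι^𝔻_δ`, `δ = imagUnit L`).  Let `χ′` be a second splitting Hecke character
whose inverse local components at the places over `v` are those of `χ` composed with the local involutions `σ_w` (hypothesis `hχχ′`; the
CONJUGATE character `χ ∘ c` — discharged by the consumer from ★ `HeckeCharacter.galConj`).  Then

  **`Σ_χ ∘ bar = scaleTransport_{−1}(Σ^{T₀′}_{χ′})`**,  `T₀′ = (−1)•T₀`   (`localSplittingDatumCM_comp_localPiGalConj_eq_scaleTransportSection`),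

as homomorphisms `H(F_v) →* S̃p_ψ(𝕎^𝔻_v, β_{T₀ ⊕ −T₀})`, where `bar` is entrywise `c ⊗ 1` (★ `localPiGalConj`, p834029) and `scaleTransport_{−1}` is the
tree's model transport `(−T, δ) ≅ (T, −δ)` (★ `scaleTransportSection`, `LocalScaleModelTransport`).  PROOF = ★ Kudla rigidity
`eq_of_parabolic_toRep_conj_eq` fed with: (i) equal projections — `ι_δ(p̄) = ι_{−δ}(p)` (★ `iota_neg_eq_iota_galConj`) and `−δ = (−1)⁻¹δ`
(`iota_congr_delta`); (ii) `bar` preserves `P_Δ` (★ P1a `IsSiegelDelta.localPiGalConj`); (iii) the `P_Δ`-scalars agree — at `p̄` the scalar of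
`Σ_χ` is `χ_v(det_Δ p̄)⁻¹ ∏‖det_Δ p̄_w‖^{1/2}` (★ `parabolic_toRep_conj_localSplittingDatumCM`, ANY mover `m`), which by ★ P1b
(`chiDet_localPiGalConj_of_forall_smul_eq`, `norm_detDelta_localPiGalConj_of_smul_eq`) and `hχχ′` is the scalar of `Σ_{χ′}` at `p`, which in turn is
the scalar of the scale-transported `Σ^{T₀′}_{χ′}` (★ `parabolic_toRep_conj_scaleTransport_localSplittingDatumCM`); (iv) every character of `H(F_v)`
trivial on `P_Δ` is trivial (★ `eq_one_of_forall_isSiegelDelta_eq_one'`).  The mover `m` of `ℓ_Δ` onto `ℓ_Y` is a hypothesis (the consumer lifts ★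
`deltaD` as in ★ S6a `LocalLineIsometryNaturality`).  Undoubling commutes with `bar` for free (the operators are literally the same), so the
undoubled statement «`s_{λ,a} ∘ bar = s_{λᶜ,−a}`» of the road card is this theorem read through ★ `scaleTransportSection_localSplittingCMWith`.
Nothing of the cited sources is asserted; HC_CM is proved only modulo the printed citations until rung 0 closes.

## References
* [Kudla1994] S. Kudla, *Splitting metaplectic covers of dual reductive pairs*, Israel J. Math. 87 (1994), §3 Thm. 3.1.
* [HarrisKudlaSweet1996] M. Harris, S. Kudla, W. Sweet, J. AMS 9 (1996), §1 (1.11)–(1.16).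
* [GelbartRogawski1991] S. Gelbart, J. Rogawski, Invent. Math. 105 (1991), §3.1 Prop. 3.1.1 p. 455, Remark p. 457 L4–13.
* [Liu2021] Y. Liu, Camb. J. Math. 9 (2021), App. D Lem. D.1 (2), (4) (l. 5231, 5235): `μ ↦ μ^c`, `ε ↦ −ε`.
-/

set_option autoImplicit false
-- buildfix G11b-3 recipe (LEDGER B13-1/B13-3), as in the GelbartRogawski1991 siblings: elaborate sequentially.
set_option Elab.async false

noncomputable section

open scoped Matrix
open NumberField IsDedekindDomain MeasureTheory Matrix
open Literature.RepresentationTheory.HeisenbergGroup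
open Literature.NumberTheory.Automorphic Literature.NumberTheory.Automorphic.UnitaryGroup Literature.NumberTheory.Weil1964
open Literature.NumberTheory.GaloisRepresentations Literature.RepresentationTheory.HarrisKudlaSweet1996

namespace Literature.NumberTheory.GelbartRogawski1991.UnitaryDualPair.LocalSplitting

/-! ## §0 `ι` does not depend on the name of the trace-zero element -/

/-- `ι^T_{δ₁} = ι^T_{δ₂}` for EQUAL trace-zero elements `δ₁ = δ₂` (the proof arguments and the squares `d₁, d₂` are irrelevant).
[cite: MoeglinVignerasWaldspurger1987, Chap. 1 I.17] -/
theorem iota_congr_delta (F : Type) [Field F] [NumberField F] (E : Type) [Field E] [NumberField E] [Algebra F E]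
    [Algebra.IsQuadraticExtension F E] (c : E ≃ₐ[F] E) (N : ℕ) {δ₁ δ₂ : E} (hδ₁₂ : δ₁ = δ₂)
    (hc₁ : c δ₁ = -δ₁) (h0₁ : δ₁ ≠ 0) {d₁ : F} (hd₁ : δ₁ * δ₁ = algebraMap F E d₁)
    (hc₂ : c δ₂ = -δ₂) (h0₂ : δ₂ ≠ 0) {d₂ : F} (hd₂ : δ₂ * δ₂ = algebraMap F E d₂)
    (T : Matrix (Fin N) (Fin N) F) (hT : T.IsSymm) {J : Matrix (Fin N) (Fin N) E} (hJ : J = T.map (algebraMap F E))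
    (v : HeightOneSpectrum (𝓞 F)) :
    iota F E c N hc₁ h0₁ hd₁ T hT hJ v = iota F E c N hc₂ h0₂ hd₂ T hT hJ v := by
  subst hδ₁₂
  obtain rfl : d₁ = d₂ := (algebraMap F E).injective (hd₁.symm.trans hd₂)
  rfl

variable (L : Type) [Field L] [NumberField L] [IsCMField L] (v : HeightOneSpectrum (𝓞 (maximalRealSubfield L)))
  [MeasurableSpace (v.adicCompletion (maximalRealSubfield L))] [BorelSpace (v.adicCompletion (maximalRealSubfield L))]
  (μ : Measure (v.adicCompletion (maximalRealSubfield L))) [μ.IsAddHaarMeasure]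
  (n : ℕ) {T₀ T₀' : Matrix (Fin n) (Fin n) (maximalRealSubfield L)}

/-- `−δ = (−1)⁻¹ · δ` for `δ = imagUnit L` (the scale transport at `a = −1` is over `ι_{(−1)⁻¹δ}`, the conjugation over `ι_{−δ}`). [folklore] -/
private theorem neg_imagUnit_eq_lineDelta :
    -imagUnit L = algebraMap (maximalRealSubfield L) L (↑(-1 : (maximalRealSubfield L)ˣ)⁻¹ : maximalRealSubfield L) * imagUnit L := by
  rw [inv_neg, inv_one, Units.val_neg, Units.val_one, map_neg, map_one, neg_one_mul]

/-! ## §1 The rigidity theorem -/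

set_option synthInstance.maxHeartbeats 400000 in
set_option maxHeartbeats 4000000 in
/-- **KUDLA RIGIDITY UNDER `g ↦ ḡ` (doubled level, non-split place).**  For a diagonal invertible `T₀`, `T₀′ = (−1)•T₀`, splitting Hecke characters
`χ, χ′` with `(χ′_w)⁻¹ = (χ_w)⁻¹ ∘ σ_w` at the places over the non-split `v` (`hχχ′`), and ANY mover `m` of `ℓ_Δ` onto `ℓ_Y`:
the doubled CM section of `χ` composed with the Galois conjugation `bar` of `H(F_v) = U(T₀ ⊕ −T₀)(F_v)` EQUALS the scale transport at `a = −1` of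
the doubled CM section of `χ′` for `T₀′` — both are `P_Δ`-normalised sections over `ι^𝔻_{−δ}` with the same scalar.
[cite: Kudla1994, §3 Thm 3.1] [cite: HarrisKudlaSweet1996, §1 (1.16)] [cite: GelbartRogawski1991, §3.1 Remark p. 457 L4–13] -/
theorem localSplittingDatumCM_comp_localPiGalConj_eq_scaleTransportSection (hn : 0 < n)
    (t : Fin n → maximalRealSubfield L) (hT₀t : T₀ = Matrix.diagonal t) (hT₀ : T₀.IsSymm) (hT₀d : IsUnit T₀.det)
    (hT₀' : T₀'.IsSymm) (hT₀'d : IsUnit T₀'.det) (hTT₀ : T₀' = ((-1 : (maximalRealSubfield L)ˣ) : maximalRealSubfield L) • T₀)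
    (hns : ∀ w : PlacesOver L v, IsCMField.complexConj L • w.1 = w.1)
    (χ χ' : HeckeCharacter L) (hχ : IsSplittingChar L 1 χ) (hχ' : IsSplittingChar L 1 χ')
    (hχχ' : ∀ (w : PlacesOver L v),
      (χ'.localComponent w.1)⁻¹ = (χ.localComponent w.1)⁻¹.comp
        (Units.map (galAdicCompletionMap (L := L) (IsCMField.complexConj L) (hns w) : w.1.adicCompletion L →* w.1.adicCompletion L)))
    (m : LocalMp (maximalRealSubfield L) (n + n) (gramD (maximalRealSubfield L) n T₀) v)
    (hm : (deltaLagrangian (maximalRealSubfield L) v n).map (toLin (maximalRealSubfield L) v (MpPsi.proj _ m)) =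
      lagrangianY (maximalRealSubfield L) (n + n) v) :
    (localSplittingDatumCM L v μ n hT₀ hT₀d rfl χ hχ).localSplitting.comp
        (localPiGalConj L (IsCMField.complexConj L) (n + n) v
          (rfl : (gramD (maximalRealSubfield L) n T₀).map (algebraMap (maximalRealSubfield L) L) =
            (gramD (maximalRealSubfield L) n T₀).map (algebraMap (maximalRealSubfield L) L))) =
      scaleTransportSection (maximalRealSubfield L) L (IsCMField.complexConj L) (n + n) (complexConj_imagUnit L) (imagUnit_ne_zero L)
        (imagUnit_mul_self L) (gramD (maximalRealSubfield L) n T₀) (gramD (maximalRealSubfield L) n T₀')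
        (gramD_isSymm (maximalRealSubfield L) n hT₀) (gramD_isSymm (maximalRealSubfield L) n hT₀') (-1)
        (gramD_of_eq_smul (maximalRealSubfield L) (-1) hTT₀) rfl rfl v
        (localSplittingDatumCM L v μ n hT₀' hT₀'d rfl χ' hχ').localSplitting
        (localSplittingDatumCM L v μ n hT₀' hT₀'d rfl χ' hχ').proj_localSplitting := by
  have hc1 : (IsCMField.complexConj L) ≠ 1 := UnitaryGroup.algEquiv_ne_one_of_apply_eq_neg (maximalRealSubfield L) L (IsCMField.complexConj L) (complexConj_imagUnit L) (imagUnit_ne_zero L)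
  have hcδ' : (IsCMField.complexConj L) (-imagUnit L) = -(-imagUnit L) := by rw [map_neg, complexConj_imagUnit]
  have hδ' : -imagUnit L ≠ 0 := neg_ne_zero.2 (imagUnit_ne_zero L)
  have hd' : -imagUnit L * -imagUnit L = algebraMap (maximalRealSubfield L) L (imagUnitSq L) := by rw [neg_mul_neg, imagUnit_mul_self]
  -- the common embedding `ι_{−δ} = ι_{(−1)⁻¹δ}`
  have hι : iota (maximalRealSubfield L) L (IsCMField.complexConj L) (n + n) hcδ' hδ' hd' (gramD (maximalRealSubfield L) n T₀) (gramD_isSymm (maximalRealSubfield L) n hT₀) rfl v =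
      iota (maximalRealSubfield L) L (IsCMField.complexConj L) (n + n) (conj_lineDelta (complexConj_imagUnit L) (-1)) (lineDelta_ne_zero (imagUnit_ne_zero L) (-1))
        (lineDelta_mul_self (imagUnit_mul_self L) (-1)) (gramD (maximalRealSubfield L) n T₀) (gramD_isSymm (maximalRealSubfield L) n hT₀) rfl v :=
    iota_congr_delta (maximalRealSubfield L) L (IsCMField.complexConj L) (n + n) (neg_imagUnit_eq_lineDelta L) hcδ' hδ' hd' _ _ _ (gramD (maximalRealSubfield L) n T₀) (gramD_isSymm (maximalRealSubfield L) n hT₀) rfl v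
  -- the χ-families: `χ` read through `σ_w` is `χ′`
  have hfam : (fun w : PlacesOver L v => ((χ.localComponent w.1)⁻¹).comp
      (Units.map (galAdicCompletionMap (L := L) (IsCMField.complexConj L) (hns w) : w.1.adicCompletion L →* w.1.adicCompletion L))) =
      fun w : PlacesOver L v => (χ'.localComponent w.1)⁻¹ := funext fun w => (hχχ' w).symm
  refine eq_of_parabolic_toRep_conj_eq (maximalRealSubfield L) L (IsCMField.complexConj L) (conj_lineDelta (complexConj_imagUnit L) (-1))
    (lineDelta_ne_zero (imagUnit_ne_zero L) (-1)) (lineDelta_mul_self (imagUnit_mul_self L) (-1)) v n hT₀ hT₀d rfl _ _ ?_ ?_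
    (fun p => (((chiDet (maximalRealSubfield L) L (IsCMField.complexConj L) v n (fun w' : PlacesOver L v => (χ'.localComponent w'.1)⁻¹) p)⁻¹ : ℂˣ) : ℂ) *
      ((∏ w' : PlacesOver L v, Real.sqrt ‖detDelta (maximalRealSubfield L) L (IsCMField.complexConj L) v n w' p‖ : ℝ) : ℂ)) ?_ m ?_ ?_
  · -- (i) equal projections
    intro g
    rw [MonoidHom.comp_apply, LocalSplittingDatum.proj_localSplitting, proj_scaleTransportSection,
      ← iota_neg_eq_iota_galConj (maximalRealSubfield L) L (IsCMField.complexConj L) (n + n) (complexConj_imagUnit L) (imagUnit_ne_zero L) (imagUnit_mul_self L) hcδ' hδ' hd'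
        (gramD (maximalRealSubfield L) n T₀) (gramD_isSymm (maximalRealSubfield L) n hT₀) rfl v g, hι]
  · -- (iv) characters trivial on `P_Δ` are trivial
    exact fun θ hθ => eq_one_of_forall_isSiegelDelta_eq_one' (maximalRealSubfield L) L (IsCMField.complexConj L) (conj_lineDelta (complexConj_imagUnit L) (-1))
      (lineDelta_ne_zero (imagUnit_ne_zero L) (-1)) (lineDelta_mul_self (imagUnit_mul_self L) (-1)) v n hn t hT₀t hT₀ hT₀d rfl θ hθ
  · -- the scalar does not vanish on `P_Δ`
    intro p hp
    refine mul_ne_zero (Units.ne_zero _) ?_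
    rw [Complex.ofReal_ne_zero]
    refine Finset.prod_ne_zero_iff.2 fun w' _ => ?_
    rw [Real.sqrt_ne_zero (norm_nonneg _), norm_ne_zero_iff]
    exact detDelta_ne_zero (maximalRealSubfield L) L (IsCMField.complexConj L) (conj_lineDelta (complexConj_imagUnit L) (-1)) (lineDelta_ne_zero (imagUnit_ne_zero L) (-1))
      (lineDelta_mul_self (imagUnit_mul_self L) (-1)) v n hT₀ rfl hp w'
  · -- (iii-a) the scale-transported `χ′`-section is normalised with the scalar
    intro p hp Φ
    exact parabolic_toRep_conj_scaleTransport_localSplittingDatumCM L v μ n (-1) hT₀ hT₀' hT₀'d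
      (gramD_of_eq_smul (maximalRealSubfield L) (-1) hTT₀) χ' hχ' m hm p hp Φ
  · -- (iii-b) the conjugated `χ`-section is normalised with the same scalar
    intro p hp Φ
    -- `p ∈ P_Δ` in the `imagUnit`-currency, hence `p̄ ∈ P_Δ`
    have hp₀ : IsSiegelDelta (maximalRealSubfield L) L (IsCMField.complexConj L) (complexConj_imagUnit L) (imagUnit_ne_zero L) (imagUnit_mul_self L) v n hT₀ rfl p :=
      (isSiegelDelta_iff_of_delta (maximalRealSubfield L) L (IsCMField.complexConj L) (complexConj_imagUnit L) (imagUnit_ne_zero L) (imagUnit_mul_self L) v n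
        (conj_lineDelta (complexConj_imagUnit L) (-1)) (lineDelta_ne_zero (imagUnit_ne_zero L) (-1))
        (lineDelta_mul_self (imagUnit_mul_self L) (-1)) hT₀ hT₀ rfl rfl p).1 hp
    have hpbar := IsSiegelDelta.localPiGalConj (maximalRealSubfield L) L (IsCMField.complexConj L) (complexConj_imagUnit L) (imagUnit_ne_zero L) (imagUnit_mul_self L) v n hT₀ rfl hp₀
    have key := parabolic_toRep_conj_localSplittingDatumCM L v μ n hT₀ hT₀d rfl χ hχ m hm _ hpbar Φ
    rw [MonoidHom.comp_apply, key, chiDet_localPiGalConj_of_forall_smul_eq (maximalRealSubfield L) L (IsCMField.complexConj L) hc1 v n rfl hns, hfam]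
    congr 2
    push_cast
    exact Finset.prod_congr rfl fun w' _ => by
      rw [norm_detDelta_localPiGalConj_of_smul_eq (maximalRealSubfield L) L (IsCMField.complexConj L) hc1 v n rfl w' (hns w') p]

end Literature.NumberTheory.GelbartRogawski1991.UnitaryDualPair.LocalSplitting

end
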